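import Summits.BirchSwinnertonDyer.Rank1Residual.ManinAdditive.NineShiftFineReduction
import Summits.BirchSwinnertonDyer.BirchSwinnertonDyer.Theorems.ManinLocalTwoThreeDeltaHomDiamond
import HarnessLib
import HarnessLib.Audit.Tags

/-!
# The t = 3 BASE E-es-102 ⟸ E-es-107 SERRE'S AMALGAM for `Γ₀(N; ℤ[1/3])` (Hom-form) — typed obligation + PROVED edge
# (es g23, MEMO-es §37.11; cell `bsd-f2-manin`, T-es-33, typer g16)

TYPER FRAMING.  LENS = es.  SOURCE = HOME/es/ThreeShiftBase-es-g23.lean sha16 **c97603435d89fd79** (214 l.; imports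
`…NineShiftFineReduction` + p-seat file `Theorems.ManinLocalTwoThreeDeltaHomDiamond` (cone-free: ConjSpanGenAllLevels* + Literature);
farm rc 0 · 0 err · 0 warn · 0 sorry per es; audit 1 conjecture node + proof-of-item edge), landed VERBATIM except this header and two
added one-line docstrings (`kappa_apply_one_one`, `kappa_apply_one_zero`).  TYPER'S CHOICE (es offered «Summits obligation node OR
Literature named fact [Serre, Trees II.1.4 Th. 3]»): the Summits node — the Hom-form statement is phrased over Summits vocabulary
(`ConjSpanGenAllLevels.Delta/iota`, `NineShiftEqualiser.g0Of`, the new `kappa`), which a Literature fact may not import (a Mathlib-only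
restatement + `Iff` bridge is a possible follow-up; the printed theorem itself — Serre's amalgam for `SL₂` over `ℤ[1/p]` at level `N`,
`p ∤ N` — is cited below by name and locator).  NOTHING IS ASSERTED: ONE `@[conjecture]` obligation node **E-es-107
`ThreeShiftAmalgamExtensionAll`** (single-level schema `ThreeShiftAmalgamExtension N`), the vertex-group embedding `kappa`
(`κ(γ) = A₃⁻¹γA₃ = (a, b/3; 3c, d) ∈ SL₂(ℤ[1/3])`), and PROVED: the cube-root trick (`deltaHom_upperUnip_eq_zero`,
`deltaHom_lowerUnip_eq_zero`: a `Δ₃(N)`-additive map to `ℤ/3` kills unipotents), `threeShiftInvariantIsDiamondAt_of_amalgam`,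
`threeShiftAntiInvariantTrivialAt_of_amalgam` (via the tree's Vaserstein diamond bottom `exists_diamond_of_deltaHom_of_dvd` /
`deltaHom_eq_of_sub_mem_span`), and the EDGE **`threeShiftBasePrimeToThree_of_amalgam : ThreeShiftAmalgamExtensionAll →
ThreeShiftBasePrimeToThree`** (E-es-107 ⟹ E-es-102).  With p3 g10's by-name theorems `threeShiftAntiInvariantDescent_holds` (E-es-99),
`threeShiftStepNine_holds` (E-es-105) and `towerReduction_holds` (E-es-101), the es-side opens of C3's chain are now
{E-es-107 (printed theorem, this node), E-es-98 (III), E-es-103, E-es-104, E-es-106}.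
PRINT: J.-P. Serre, *Trees* (1980), I.4.1 Th. 6 and II.1.4 Th. 3 (SL₂ over `ℤ[1/p]` as an amalgam of two copies of `SL₂(ℤ)` over
`Γ₀(p)`); level-`N` form: B. Conrad, F. Diamond, R. Taylor, JAMS 12 (1999) p. 549.  REFUTER VERDICTS: §R97-B (referee PASS of the
paper derivation MEMO-es §37.4/§37.9 (7)); R-es-50 (light: BC7-by-name of E-es-107 + placement of the Δ₃(N) edge-transitivity) PENDING
at filing.  bears_on: stmt-BirchSwinnertonDyer-22968.  PARTITION 0 · beyond-print theorem: no · BSD is not proved by this; Manin's law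
`c ∈ {±1}` is not proved by this; C3 stays OPEN.
-/

/-!
## es's sketch docstring (verbatim)
# The t = 3 BASE E-es-102 `ThreeShiftBasePrimeToThree` from SERRE'S AMALGAM for `Γ₀(N; ℤ[1/3])` (Hom-form)
# and the tree's Vaserstein diamond bottom — PROVED edge (es g23, MEMO-es §37.11; cell `bsd-f2-manin`)

LENS = es.  Of the six f-free obligations of `NineShiftFineReduction.lean`, the BASE
`ThreeShiftBasePrimeToThree` (`K₃(N₀) = D(N₀)` and `K₃⁻(N₀) = 0` for `3 ∤ N₀`) is proved on paper (MEMO-es §37.4,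
§37.9 (7); referee PASS §R97-B) from exactly ONE printed input — Serre's amalgam
`Γ₀(N₀; ℤ[1/3]) = Γ₀(N₀) *_{Γ₀(3N₀)} A₃⁻¹Γ₀(N₀)A₃` (`A₃ = diag(3,1)`; Serre, *Trees*, I.4.1 Th. 6 + II.1.4 Th. 3;
level-`N` form Conrad–Diamond–Taylor, JAMS 12 (1999) p. 549) — plus the «cube-root trick» and Vaserstein's theorem
over `ℤ[1/3]`, which the tree HOLDS (`SL2Rel.Away.relG_top_span_natCast_le_relE`) together with its diamond
consequence `ManinLocalTwoThree.exists_diamond_of_deltaHom_of_dvd` / `deltaHom_eq_of_sub_mem_span`.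

THIS FILE types the single printed input in HOM-FORM as ONE obligation node
`ThreeShiftAmalgamExtension N` (E-es-107: a compatible pair of additive maps on `Γ₀(N)` and on `A₃⁻¹Γ₀(N)A₃`
extends to a `Δ₃(N)`-additive map on `SL₂(ℤ[1/3])`; nothing asserted) and PROVES
`threeShiftBasePrimeToThree_of_amalgam : ThreeShiftAmalgamExtensionAll → ThreeShiftBasePrimeToThree`
(`ThreeShiftAmalgamExtensionAll := ∀ N, 0 < N → ¬ 3 ∣ N → ThreeShiftAmalgamExtension N`) — so the base node is reduced, in the kernel, to a corollary of a 1977 theorem.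
PARTITION 0 · beyond-print theorem: no · BSD is not proved by this; Manin's conjecture is not proved by this.
-/

open scoped MatrixGroups

open CongruenceSubgroup
open Summit.BirchSwinnertonDyer.BirchSwinnertonDyer.Theorems.ConjSpanGenAllLevels (Away iota upperUnip lowerUnip
  Delta iota_apply)
open Summit.BirchSwinnertonDyer.BirchSwinnertonDyer.Theorems.ManinLocalTwoThree (upperUnip_eq_e12 lowerUnip_eq_e21
  upperUnip_mem_Delta lowerUnip_mul_mem_Delta iota_mem_Delta deltaHom_eq_of_sub_mem_span
  exists_diamond_of_deltaHom_of_dvd)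
open Literature.NumberTheory.Automorphic (SL2Rel.e12_add SL2Rel.e21_add)

namespace Summit.BirchSwinnertonDyer.Rank1Residual.ManinAdditive.NineShiftEqualiser

noncomputable section

/-! ### §1  The second vertex group: `κ(γ) = A₃⁻¹ γ A₃ = (a, b/3; 3c, d) ∈ SL₂(ℤ[1/3])` -/

/-- `3 · 3⁻¹ = 1` in `ℤ[1/3]`. [folklore] -/
theorem three_mul_invSelf :
    (3 : Away 3) * IsLocalization.Away.invSelf (S := Away 3) ((3 : ℕ) : ℤ) = 1 := by
  have h := IsLocalization.Away.mul_invSelf (S := Away 3) ((3 : ℕ) : ℤ)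
  simpa using h

/-- `κ(γ) := A₃⁻¹ γ A₃ = (a, b/3; 3c, d)` for `γ = (a b; c d) ∈ SL₂(ℤ)`, `A₃ = diag(3, 1)`: the stabiliser
`A₃⁻¹ SL₂(ℤ) A₃` of the vertex adjacent to the standard one in the tree of `SL₂(ℚ₃)`. -/
def kappa (γ : SL(2, ℤ)) : SL(2, Away 3) :=
  ⟨!![((γ 0 0 : ℤ) : Away 3), ((γ 0 1 : ℤ) : Away 3) * IsLocalization.Away.invSelf (S := Away 3) ((3 : ℕ) : ℤ);
      (3 : Away 3) * ((γ 1 0 : ℤ) : Away 3), ((γ 1 1 : ℤ) : Away 3)], by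
    have h := Matrix.det_fin_two ((γ : SL(2, ℤ)) : Matrix (Fin 2) (Fin 2) ℤ)
    rw [γ.2] at h
    have hc : ((γ 0 0 : ℤ) : Away 3) * ((γ 1 1 : ℤ) : Away 3) - ((γ 0 1 : ℤ) : Away 3) * ((γ 1 0 : ℤ) : Away 3)
        = 1 := by
      have hc := congrArg (Int.cast : ℤ → Away 3) h.symm
      push_cast at hc
      exact hc
    rw [Matrix.det_fin_two_of]
    linear_combination hc - ((γ 0 1 : ℤ) : Away 3) * ((γ 1 0 : ℤ) : Away 3) * three_mul_invSelf⟩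

/-- entry `(1,1)` of `κ(γ)` is `d`. [folklore] -/
theorem kappa_apply_one_one (γ : SL(2, ℤ)) : (kappa γ) 1 1 = ((γ 1 1 : ℤ) : Away 3) := rfl

/-- entry `(1,0)` of `κ(γ)` is `3c`. [folklore] -/
@[simp] theorem kappa_apply_one_zero (γ : SL(2, ℤ)) : (kappa γ) 1 0 = (3 : Away 3) * ((γ 1 0 : ℤ) : Away 3) :=
  rfl

/-- `κ(Γ₀(N)) ≤ Δ₃(N)`. [folklore] -/
theorem kappa_mem_Delta {N : ℕ} {γ : SL(2, ℤ)} (hγ : γ ∈ Gamma0 N) : kappa γ ∈ Delta 3 N := by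
  rw [Gamma0_mem] at hγ
  obtain ⟨k, hk⟩ := (ZMod.intCast_zmod_eq_zero_iff_dvd _ N).mp hγ
  refine ⟨3 * (k : Away 3), ?_⟩
  rw [kappa_apply_one_zero, hk]
  push_cast
  ring

/-! ### §2  THE PRINTED INPUT, Hom-form: Serre's amalgam for `Δ₃(N) = Γ₀(N; ℤ[1/3])`, `3 ∤ N` -/

/-- **E-es-107 — SERRE'S AMALGAM FOR `Γ₀(N; ℤ[1/3])`, HOM-FORM** (`3 ∤ N`, `N ≥ 1`).  `Δ₃(N) = {g ∈ SL₂(ℤ[1/3]) :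
c_g ∈ Nℤ[1/3]}` acts on the tree of `SL₂(ℚ₃)` without inversion, transitively on edges, with vertex stabilisers
`ι Γ₀(N)` and `κ Γ₀(N) = A₃⁻¹Γ₀(N)A₃` meeting in `ι Γ₀(3N)`; hence `Δ₃(N) = Γ₀(N) *_{Γ₀(3N)} A₃⁻¹Γ₀(N)A₃`
[Serre, *Trees*, I.4.1 Th. 6, II.1.4 Th. 3; Conrad–Diamond–Taylor, JAMS 12 (1999) p. 549].  Stated as its universal
property for maps to an abelian group `K`: two additive maps `φ₁, φ₂ : Γ₀(N) → K` which are COMPATIBLE on the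
intersection (`φ₁(a b; 3c d) = φ₂(a 3b; c d)`, i.e. `φ₁(g) = φ₂(γ)` whenever `ι g = κ γ`) are the restrictions along
`ι` and `κ` of one `Δ₃(N)`-additive map `Φ` on `SL₂(ℤ[1/3])`.  With `φ₁ = φ₂ = φ` compatibility is
`IsThreeShiftInvariant φ`; with `(ψ, −ψ)` it is `IsThreeShiftAntiInvariant ψ`.
(Single-level form; the obligation node is `ThreeShiftAmalgamExtensionAll`.) -/
def ThreeShiftAmalgamExtension (N : ℕ) : Prop :=
  ∀ (K : Type) [AddCommGroup K] (φ₁ φ₂ : Gamma0 N → K),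
    (∀ γ δ : Gamma0 N, φ₁ (γ * δ) = φ₁ γ + φ₁ δ) → (∀ γ δ : Gamma0 N, φ₂ (γ * δ) = φ₂ γ + φ₂ δ) →
    (∀ (a b c d : ℤ) (hdet : a * d - b * (3 * c) = 1) (hc : (N : ℤ) ∣ c),
        φ₁ (g0Of a b (3 * c) d hdet (Dvd.dvd.mul_left hc 3)) = φ₂ (g0Of a (3 * b) c d (by linear_combination hdet) hc)) →
    ∃ Φ : SL(2, Away 3) → K,
      (∀ g ∈ Delta 3 N, ∀ g' ∈ Delta 3 N, Φ (g * g') = Φ g + Φ g') ∧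
      (∀ γ : Gamma0 N, Φ (iota 3 (γ : SL(2, ℤ))) = φ₁ γ) ∧
      (∀ γ : Gamma0 N, Φ (kappa (γ : SL(2, ℤ))) = φ₂ γ)

/-- **E-es-107 (obligation node) — Serre's amalgam, Hom-form, at EVERY level prime to `3`.**
TYPER FRAMING (E-es-107): lens es; corollary of a PRINTED THEOREM [Serre, *Trees*, I.4.1 Th. 6, II.1.4 Th. 3;
Conrad–Diamond–Taylor 1999 p. 549] (obligation node until ported), nothing asserted.
[conjecture — cell candidate, NOT a tree fact] -/
@[conjecture] def ThreeShiftAmalgamExtensionAll : Prop :=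
  ∀ N : ℕ, 0 < N → ¬ 3 ∣ N → ThreeShiftAmalgamExtension N

/-! ### §3  The cube-root trick: a `Δ₃(N)`-additive map to `ℤ/3` kills the unipotents -/

section CubeRoot

variable {N : ℕ} (Φ : SL(2, Away 3) → ZMod 3)
  (hadd : ∀ g ∈ Delta 3 N, ∀ g' ∈ Delta 3 N, Φ (g * g') = Φ g + Φ g')

include hadd

/-- `Φ(U⁺(x)) = 0`: `U⁺(x) = U⁺(x/3)³` and `3 = 0` in `ℤ/3`. [folklore] -/
theorem deltaHom_upperUnip_eq_zero (x : Away 3) : Φ (upperUnip x) = 0 := by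
  set y : Away 3 := x * IsLocalization.Away.invSelf (S := Away 3) ((3 : ℕ) : ℤ) with hy
  have hx : x = y + y + y := by
    have : y + y + y = x * ((3 : Away 3) * IsLocalization.Away.invSelf (S := Away 3) ((3 : ℕ) : ℤ)) := by
      rw [hy]; ring
    rw [this, three_mul_invSelf, mul_one]
  have hmem : upperUnip y ∈ Delta 3 N := upperUnip_mem_Delta y
  have h2 : upperUnip (y + y) = upperUnip y * upperUnip y := by
    rw [upperUnip_eq_e12, upperUnip_eq_e12, SL2Rel.e12_add]
  have h3 : upperUnip x = upperUnip (y + y) * upperUnip y := by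
    rw [hx, upperUnip_eq_e12, upperUnip_eq_e12, upperUnip_eq_e12, SL2Rel.e12_add]
  have hmem2 : upperUnip (y + y) ∈ Delta 3 N := by rw [h2]; exact Subgroup.mul_mem _ hmem hmem
  rw [h3, hadd _ hmem2 _ hmem, h2, hadd _ hmem _ hmem]
  have hz : ∀ z : ZMod 3, z + z + z = 0 := by decide
  exact hz _

/-- `Φ(U⁻(Ny)) = 0`: `U⁻(Ny) = U⁻(Ny/3)³`. [folklore] -/
theorem deltaHom_lowerUnip_eq_zero (y : Away 3) : Φ (lowerUnip ((N : Away 3) * y)) = 0 := by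
  set z : Away 3 := y * IsLocalization.Away.invSelf (S := Away 3) ((3 : ℕ) : ℤ) with hz
  have hy : (N : Away 3) * y = (N : Away 3) * z + (N : Away 3) * z + (N : Away 3) * z := by
    have : (N : Away 3) * z + (N : Away 3) * z + (N : Away 3) * z
        = (N : Away 3) * y * ((3 : Away 3) * IsLocalization.Away.invSelf (S := Away 3) ((3 : ℕ) : ℤ)) := by
      rw [hz]; ring
    rw [this, three_mul_invSelf, mul_one]
  have hmem : lowerUnip ((N : Away 3) * z) ∈ Delta 3 N := lowerUnip_mul_mem_Delta z
  have h2 : lowerUnip ((N : Away 3) * z + (N : Away 3) * z) = lowerUnip ((N : Away 3) * z) * lowerUnip ((N : Away 3) * z) := by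
    rw [lowerUnip_eq_e21, lowerUnip_eq_e21, SL2Rel.e21_add]
  have h3 : lowerUnip ((N : Away 3) * y)
      = lowerUnip ((N : Away 3) * z + (N : Away 3) * z) * lowerUnip ((N : Away 3) * z) := by
    rw [hy, lowerUnip_eq_e21, lowerUnip_eq_e21, lowerUnip_eq_e21, SL2Rel.e21_add]
  have hmem2 : lowerUnip ((N : Away 3) * z + (N : Away 3) * z) ∈ Delta 3 N := by
    rw [h2]; exact Subgroup.mul_mem _ hmem hmem
  rw [h3, hadd _ hmem2 _ hmem, h2, hadd _ hmem _ hmem]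
  have hz : ∀ z : ZMod 3, z + z + z = 0 := by decide
  exact hz _

end CubeRoot

/-! ### §4  THE BASE from the amalgam -/

section Base

variable {N : ℕ}

/-- `K₃(N) = D(N)` for `3 ∤ N` from E-es-107: the amalgam extension `Φ` of `(φ, φ)` kills the unipotents (cube
root), hence is a diamond character by Vaserstein (tree `exists_diamond_of_deltaHom_of_dvd`), so `φ` kills `Γ₁(N)`. -/
theorem threeShiftInvariantIsDiamondAt_of_amalgam (hN : 0 < N) (hA : ThreeShiftAmalgamExtension N) :
    ThreeShiftInvariantIsDiamondAt N := by
  haveI : NeZero N := ⟨hN.ne'⟩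
  intro φ hadd hinv
  obtain ⟨Φ, hΦ, hι, -⟩ := hA (ZMod 3) φ φ hadd hadd (fun a b c d hdet hc => (hinv a b c d hdet hc).symm)
  have hU := deltaHom_upperUnip_eq_zero Φ hΦ
  have hL := deltaHom_lowerUnip_eq_zero Φ hΦ
  obtain ⟨η, hη, hd⟩ := exists_diamond_of_deltaHom_of_dvd Φ hΦ hU hL (by norm_num) (dvd_refl N)
  have hη1 : η 1 = 0 := by
    have h := hη 1 1 isUnit_one isUnit_one
    rw [one_mul] at h
    have hz : ∀ z : ZMod 3, z = z + z → z = 0 := by decide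
    exact hz _ h
  intro γ hγ
  have h1 : (((γ 1 1 : ℤ) : ZMod N)) = 1 := ((Gamma1_mem N γ).1 hγ).2.1
  rw [← hι, hd]
  simpa [h1] using hη1

/-- `K₃⁻(N) = 0` for `3 ∤ N` from E-es-107: the extension `Φ` of `(ψ, −ψ)` kills the unipotents, so `Φ(g)` depends
only on `d_g mod N` on `Δ₃(N)` (tree `deltaHom_eq_of_sub_mem_span`); `ι γ` and `κ γ` have the same `d`, whence
`ψ γ = −ψ γ`, `ψ = 0`. -/
theorem threeShiftAntiInvariantTrivialAt_of_amalgam (hN : 0 < N) (hA : ThreeShiftAmalgamExtension N) :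
    ThreeShiftAntiInvariantTrivialAt N := by
  haveI : NeZero N := ⟨hN.ne'⟩
  intro ψ hadd hanti
  have hadd' : ∀ γ δ : Gamma0 N, (fun g => -ψ g) (γ * δ) = (fun g => -ψ g) γ + (fun g => -ψ g) δ := by
    intro γ δ
    simp only [hadd γ δ, neg_add]
  obtain ⟨Φ, hΦ, hι, hκ⟩ := hA (ZMod 3) ψ (fun g => -ψ g) hadd hadd'
    (fun a b c d hdet hc => by simp only [hanti a b c d hdet hc, neg_neg])
  have hU := deltaHom_upperUnip_eq_zero Φ hΦ
  have hL := deltaHom_lowerUnip_eq_zero Φ hΦ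
  intro γ
  have hιm : iota 3 (γ : SL(2, ℤ)) ∈ Delta 3 N := iota_mem_Delta γ.2
  have hκm : kappa (γ : SL(2, ℤ)) ∈ Delta 3 N := kappa_mem_Delta γ.2
  have heq : Φ (kappa (γ : SL(2, ℤ))) = Φ (iota 3 (γ : SL(2, ℤ))) :=
    deltaHom_eq_of_sub_mem_span Φ hΦ hU hL (by norm_num) hN.ne' hιm hκm (by simp [kappa_apply_one_one])
  rw [hι, hκ] at heq
  have hz : ∀ z : ZMod 3, -z = z → z = 0 := by decide
  exact hz _ heq

/-- **E-es-102 ⟸ E-es-107 (PROVED edge).**  The t = 3 base of the fine reduction follows from Serre's amalgam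
(Hom-form) at every level prime to `3`. -/
theorem threeShiftBasePrimeToThree_of_amalgam (hA : ThreeShiftAmalgamExtensionAll) :
    ThreeShiftBasePrimeToThree := by
  intro N₀ hN₀ h3
  exact ⟨threeShiftInvariantIsDiamondAt_of_amalgam hN₀ (hA N₀ hN₀ h3),
    threeShiftAntiInvariantTrivialAt_of_amalgam hN₀ (hA N₀ hN₀ h3)⟩

end Base

end

end Summit.BirchSwinnertonDyer.Rank1Residual.ManinAdditive.NineShiftEqualiser
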